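import Summits.QuantumFields.YangMills.Theses.DirichletWindow
import Literature.MathematicalPhysics.QuantumLattice.LatticeGaugeDLRFreeEnergyProofs
import HarnessLib

/-!
# `DirichletWindow.CouplingReductionCost` (item stmt-QuantumFields-20195)

Route `DirichletWindow` of `QuantumFields/YangMills`, support item
`Summit.QuantumFields.YangMills.Theses.DirichletWindow.CouplingReductionCost` (K2 of the large-field-sparsity
support line): for every compact simple `G`, faithful unitary lattice representation `r` and `t ∈ (0,1)` there are
`C`, `β_t` such that for all `β ≥ β_t`, eventually in the torus side `L + 1`,
`log Z_{L+1}((1−t)β) − log Z_{L+1}(β) ≤ C (L+1)⁴` (`d = 4`).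

Proof (routine, from two tree theorems): the thermodynamic limit `exists_hasFreeEnergyDensity_holds`
(`(L+1)⁻⁴ log Z_{L+1}(b) → f(b)` for every `b`) and the closed crux `FreeEnergyLogCoefficient_holds` (item 8759:
`f(β) + c₀ log β → K`, `c₀ = 3 dim 𝔤_r / 2`) give `f((1−t)β) − f(β) → −c₀ log(1−t)`; hence for `β ≥ β_t`,
`f((1−t)β) − f(β) < C − 1/2` with `C := −c₀ log(1−t) + 1`, and then eventually in `L` the normalised finite-volume
difference is `< C`.  The arbitrary `[BorelSpace G]` structure of the item is rewritten to `borel G` (the structure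
under which 8759 is stated) by `BorelSpace.measurable_eq`; second countability of `G` comes from the faithful
continuous representation.  References: S. Chatterjee, arXiv:1602.01222 (leading free energy); Friedli–Velenik 2017
Thm. 3.6 (thermodynamic limit).  RECORD currency of a summit route: no mass gap, no continuum limit is touched.
-/

set_option autoImplicit false

noncomputable section

open MeasureTheory Filter Topology
open Literature.MathematicalPhysics.QuantumFieldTheory Literature.MathematicalPhysics.QuantumLattice

namespace Summit.QuantumFields.YangMills.Theorems

/-- **`CouplingReductionCost` holds** (item stmt-QuantumFields-20195): for `t ∈ (0,1)` there are `C`, `β_t` with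
`log Z_{L+1}((1−t)β) − log Z_{L+1}(β) ≤ C (L+1)⁴` eventually in `L`, for all `β ≥ β_t` — from the existence of the
free energy density and `f(β) + c₀ log β → K` (item 8759). -/
theorem couplingReductionCost_proof :
    Summit.QuantumFields.YangMills.Theses.DirichletWindow.CouplingReductionCost := by
  intro G _ _ _ _ mG hBG hG r t ht0 ht1
  have hm : mG = borel G := @BorelSpace.measurable_eq G _ mG hBG
  subst hm
  letI : MeasurableSpace G := borel G
  haveI : SecondCountableTopology G :=
    (r.continuous.isClosedEmbedding r.injective).isEmbedding.secondCountableTopology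
  obtain ⟨K, hK⟩ :=
    Summit.QuantumFields.YangMills.Theses.DirichletWindow.FreeEnergyLogCoefficient_holds G hG r
  -- abbreviations
  set c₀ : ℝ := 3 * (Module.finrank ℝ ↥(Submodule.span ℝ {X : Matrix (Fin r.N) (Fin r.N) ℂ |
    ∀ s : ℝ, NormedSpace.exp ((s : ℂ) • X) ∈ Set.range r.ρ}) : ℝ) / 2 with hc₀
  have hs : 0 < 1 - t := by linarith
  -- `f((1-t)β) + c₀ log((1-t)β) → K`
  have hK2 : Tendsto (fun β : ℝ => freeEnergyDensity 4 r.ρ ((1 - t) * β) +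
      c₀ * Real.log ((1 - t) * β)) atTop (𝓝 K) :=
    hK.comp (tendsto_id.const_mul_atTop hs)
  -- `f((1-t)β) − f(β) → −c₀ log(1−t)`
  have hdiff : Tendsto (fun β : ℝ => freeEnergyDensity 4 r.ρ ((1 - t) * β) - freeEnergyDensity 4 r.ρ β)
      atTop (𝓝 (-(c₀ * Real.log (1 - t)))) := by
    have h1 : Tendsto (fun β : ℝ =>
        (freeEnergyDensity 4 r.ρ ((1 - t) * β) + c₀ * Real.log ((1 - t) * β)) -
          (freeEnergyDensity 4 r.ρ β + c₀ * Real.log β) - c₀ * Real.log (1 - t)) atTop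
        (𝓝 (K - K - c₀ * Real.log (1 - t))) := (hK2.sub hK).sub tendsto_const_nhds
    rw [sub_self, zero_sub] at h1
    refine h1.congr' ?_
    filter_upwards [eventually_gt_atTop (0 : ℝ)] with β hβ
    rw [Real.log_mul hs.ne' hβ.ne']
    ring
  set C : ℝ := -(c₀ * Real.log (1 - t)) + 1 with hC
  have hev : ∀ᶠ β : ℝ in atTop,
      freeEnergyDensity 4 r.ρ ((1 - t) * β) - freeEnergyDensity 4 r.ρ β < C - 1 / 2 :=
    hdiff.eventually (gt_mem_nhds (by rw [hC]; linarith))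
  obtain ⟨βt, hβt⟩ := eventually_atTop.1 hev
  refine ⟨C, βt, fun β hβ => ?_⟩
  have hβ' := hβt β hβ
  -- thermodynamic limit at `(1-t)β` and at `β`
  have hf : ∀ b : ℝ,
      Tendsto (fun L : ℕ => (((L + 1 : ℕ) : ℝ) ^ 4)⁻¹ * torusLogPartition 4 r.ρ b (L + 1))
        atTop (𝓝 (freeEnergyDensity 4 r.ρ b)) := fun b =>
    hasFreeEnergyDensity_freeEnergyDensity r.ρ
      (exists_hasFreeEnergyDensity_holds (d := 4) r.ρ r.continuous b)
  have hfd : Tendsto (fun L : ℕ =>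
      (((L + 1 : ℕ) : ℝ) ^ 4)⁻¹ * torusLogPartition 4 r.ρ ((1 - t) * β) (L + 1) -
        (((L + 1 : ℕ) : ℝ) ^ 4)⁻¹ * torusLogPartition 4 r.ρ β (L + 1)) atTop
      (𝓝 (freeEnergyDensity 4 r.ρ ((1 - t) * β) - freeEnergyDensity 4 r.ρ β)) :=
    (hf _).sub (hf _)
  have hevL : ∀ᶠ L : ℕ in atTop,
      (((L + 1 : ℕ) : ℝ) ^ 4)⁻¹ * torusLogPartition 4 r.ρ ((1 - t) * β) (L + 1) -
        (((L + 1 : ℕ) : ℝ) ^ 4)⁻¹ * torusLogPartition 4 r.ρ β (L + 1) < C :=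
    hfd.eventually (gt_mem_nhds (by linarith))
  filter_upwards [hevL] with L hL
  have hL0 : (0 : ℝ) < ((L + 1 : ℕ) : ℝ) ^ 4 := by positivity
  have heq : (((L + 1 : ℕ) : ℝ) ^ 4)⁻¹ * torusLogPartition 4 r.ρ ((1 - t) * β) (L + 1) -
      (((L + 1 : ℕ) : ℝ) ^ 4)⁻¹ * torusLogPartition 4 r.ρ β (L + 1) =
      (torusLogPartition 4 r.ρ ((1 - t) * β) (L + 1) - torusLogPartition 4 r.ρ β (L + 1)) /
        ((L + 1 : ℕ) : ℝ) ^ 4 := by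
    field_simp
  rw [heq, div_lt_iff₀ hL0] at hL
  exact hL.le

end Summit.QuantumFields.YangMills.Theorems

end
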